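import Summits.NavierStokesRegularity.NavierStokesRegularity.Theorems.FilamentSkeletonRssTransverseReductionRCensus
import Summits.NavierStokesRegularity.NavierStokesRegularity.Theorems.FilamentSkeletonRssStraightSkeleton

/-!
# Route `FilamentSkeletonRss` · crux `TransverseReductionR` (stmt-NavierStokesRegularity-19175) — the crux may assume `K > 0`

Refutation-first lane `ns-filament-19175-p1`, second cut (2026-08-27).  The census p528784
(`transverseReductionR_iff_nondegenerate`) had `0 ≤ K`, with `0 < K` only for `N = 1`, and left «`K = 0`
vacuity for all `N`» as an unformalised footnote (analytic continuation).  With the elementary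
straight-skeleton estimate `TransverseReductionRStraight.straight_box_absurd` (route-independent file
`FilamentSkeletonRssStraightSkeleton.lean`) this file proves it for every `N`:
`transverseReductionR_iff_posCurvature` — `TransverseReductionR` is equivalent to its restriction to
`cg ≤ 1 ∧ θ₀ ≤ 1 ∧ 0 < K ∧ 3/2 + δ ≤ Λ ∧ 0 ≤ cnd ∧ (2 ≤ N → ρ ≤ 2 Rw)`; if `K ≤ 0` every filament of
a box is straight (`‖X″‖√Γ ≤ K`) and for `Γ ≥ Γ₁(N, ρ, Rw, Rb, θ₀)` the exact-tangency clause on the ball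
`‖y‖ ≤ Rb√(Γ log Γ)` is contradictory.  A prover of the crux may assume a positive curvature budget; a
refuter's witness must bend.

Negative-side bookkeeping (`--supports` stmt-19175); NOT a claim about NS regularity or blow-up.
-/

set_option linter.dupNamespace false

noncomputable section

namespace Summit.NavierStokesRegularity.NavierStokesRegularity.Theorems

open Set Function Filter MeasureTheory Real
open Literature.Analysis.FluidPDE
open Summit.NavierStokesRegularity.NavierStokesRegularity.Theses.FilamentSkeletonRss
open scoped InnerProductSpace Topology

open TransverseReductionRStraight TransverseReductionRCensus in
/-- **Parameter census, second cut: the crux may assume `0 < K`.** `TransverseReductionR` is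
equivalent to its restriction to the region
`cg ≤ 1 ∧ θ₀ ≤ 1 ∧ 0 < K ∧ 3/2 + δ ≤ Λ ∧ 0 ≤ cnd ∧ (2 ≤ N → ρ ≤ 2 Rw)`.
New over `transverseReductionR_iff_nondegenerate` (p528784, which had `0 ≤ K` and `N = 1 → 0 < K`): for
EVERY `N`, if `K ≤ 0` then every filament of a box is a straight line (`‖X″‖√Γ ≤ K`), and for
`Γ ≥ Γ₁(N, ρ, Rw, Rb, θ₀) = exp(((Rw + C₁ + 1)/Rb)²)` the exact-tangency clause on the ball
`‖y‖ ≤ Rb√(Γ log Γ)` is contradictory (`straight_box_absurd`: at the in-ball point of filament `j` at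
parameter distance `(C₁+1)√Γ` from its waist the rotation `−α e₃ × y` has normal component
`≥ θ₀ (C₁+1)√Γ √(2θ₀ − θ₀²)` along `e₃ × t_j`, while the Leray drift, the other straight filaments'
regularised Biot–Savart fields (`≤ N√Γ/(4ρθ₀)` in total) and the vanishing self-induction give at most
`θ₀ C₁ √Γ √(2θ₀−θ₀²)`).  So the all-straight skeleton is vacuous for every `N`, not only `N = 1`; a prover
of the crux may assume curvature budget `K > 0`, a refuter must use it.  Negative-side bookkeeping only;
NOT a claim about NS regularity or blow-up. [folklore] -/
theorem transverseReductionR_iff_posCurvature :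
    TransverseReductionR ↔
    (∀ (N:ℕ) (δ ρ K Λ a b cnd η Rw Rb cg θ₀:ℝ), 0 < N → 0 < δ → 0 < ρ → 0 < η → 0 < Rw → 0 < Rb → 0
      < cg → 0 < θ₀ → cg ≤ 1 → θ₀ ≤ 1 → 0 < K → 3/2+δ ≤ Λ → 0 ≤ cnd → (2 ≤ N → ρ ≤ 2*Rw) →
      ∃ Γ₁:ℝ, ∀ Γ:ℝ, Γ₁≤Γ → ∀ (γ:(Fin N → ℝ) → Fin N → ℝ) (α:(Fin N → ℝ) → ℝ) (X:(Fin N →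
      ℝ) → Fin N → ℝ → EuclideanSpace ℝ (Fin 3)) (w:(Fin N → ℝ) → Fin N → ℝ → ℝ) (c:(Fin N → ℝ) →
      Fin N → ℝ) (m n:(Fin N → ℝ) → Fin N → EuclideanSpace ℝ (Fin 3)) (u:(Fin N → ℝ)→(Fin N → ℝ →
      EuclideanSpace ℝ (Fin 3)) → EuclideanSpace ℝ (Fin 3) → EuclideanSpace ℝ (Fin 3)) (v:(Fin N →
      ℝ) → EuclideanSpace ℝ (Fin 3) → EuclideanSpace ℝ (Fin 3)) (A:(Fin N → ℝ) → Fin N →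
      (EuclideanSpace ℝ (Fin 3) →L[ℝ] EuclideanSpace ℝ (Fin 3))) (T:(Fin N → ℝ)→(Fin N → ℝ →
      EuclideanSpace ℝ (Fin 3)) → Fin N → ℝ → EuclideanSpace ℝ (Fin 3)) (D:(Fin N → ℝ) → Fin N →
      EuclideanSpace ℝ (Fin 3) → EuclideanSpace ℝ (Fin 3)), (∀ p Z y, u p Z y = ∑ k, (Γ*γ p
      k/(4*Real.pi)) • ∫ σ:ℝ, ((‖y-Z k σ‖^2+1)^(3/2:ℝ))⁻¹ • cross (deriv (Z k) σ) (y-Z k σ))→(∀ p y,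
      v p y = u p (X p) y+(1/2:ℝ) • y-α p • cross (EuclideanSpace.single 2 1) y)→(∀ p j, A p j =
      fderiv ℝ (v p) (X p j (c p j)))→(∀ p Z j τ, T p Z j τ = (u p Z (Z j τ)+(1/2:ℝ) • Z j τ-α p •
      cross (EuclideanSpace.single 2 1) (Z j τ))-(⟪u p Z (Z j τ)+(1/2:ℝ) • Z j τ-α p • cross
      (EuclideanSpace.single 2 1) (Z j τ), deriv (Z j) τ⟫_ℝ/‖deriv (Z j) τ‖^2) • deriv (Z j) τ)→(∀ p
      j y, D p j y = (Real.exp (-(⟪y-X p j (c p j), deriv (X p j) (c p j)⟫_ℝ)^2)*((1-Real.exp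
      (-(‖y-X p j (c p j)‖^2-⟪y-X p j (c p j), deriv (X p j) (c p j)⟫_ℝ^2)))/(‖y-X p j (c p
      j)‖^2-⟪y-X p j (c p j), deriv (X p j) (c p j)⟫_ℝ^2))) • cross (deriv (X p j) (c p j)) (y-X p j
      (c p j)))→((∀ j, ContinuousOn (fun q:(Fin N → ℝ) × ℝ => (α q.1, γ q.1 j, X q.1 j q.2, w q.1 j
      q.2)) ({p:Fin N → ℝ | ∀ i, p i ∈ Icc 0 1} ×ˢ univ))∧(∀ p:Fin N → ℝ, (∀ i, p i ∈ Icc 0 1) → α p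
      ≠ 0 ∧ (∀ j, γ p j ≠ 0)∧(∀ j, ContDiff ℝ 2 (X p j) ∧ Differentiable ℝ (w p j)∧(∀ τ, ‖deriv (X p
      j) τ‖ = 1)∧(∀ τ, ‖iteratedDeriv 2 (X p j) τ‖*√Γ≤K) ∧ Tendsto (fun τ => ‖X p j τ‖) (cocompact
      ℝ) atTop)∧(∀ j k, j ≠ k → ∀ τ σ, ρ*√Γ≤‖X p j τ-X p k σ‖)∧(∀ j τ σ, ρ*√Γ≤|τ-σ| → cg*ρ*√Γ≤‖X p j
      τ-X p j σ‖)∧(∀ j τ, cg*|τ-c p j|≤Rw*√Γ+‖X p j τ‖)∧(∀ j τ, w p j τ = ⟪v p (X p j τ), deriv (X p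
      j) τ⟫_ℝ)∧(∀ j τ, ‖X p j τ‖≤Rb*√(Γ*Real.log Γ) → v p (X p j τ) = w p j τ • deriv (X p j) τ)∧(∀
      j, ‖X p j (c p j)‖≤Rw*√Γ)∧(∀ j, |⟪deriv (X p j) (c p j), EuclideanSpace.single 2
      1⟫_ℝ|≤1-θ₀)∧(θ₀≤|α p| ∧ |α p|≤θ₀⁻¹ ∧ ∀ j, θ₀≤|γ p j| ∧ |γ p j|≤θ₀⁻¹)∧(∀ j, w p j (c p j) = 0 ∧
      (∀ τ, w p j τ = 0 → τ = c p j) ∧ 3/2+δ≤deriv (w p j) (c p j) ∧ deriv (w p j) (c p j)≤Λ)∧(∀ j,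
      Orthonormal ℝ ![deriv (X p j) (c p j), m p j, n p j] ∧ ⟪A p j (m p j), m p j⟫_ℝ+⟪A p j (n p
      j), n p j⟫_ℝ < 0 ∧ ⟪A p j (n p j), m p j⟫_ℝ * ⟪A p j (m p j), n p j⟫_ℝ < ⟪A p j (m p j), m p
      j⟫_ℝ * ⟪A p j (n p j), n p j⟫_ℝ)∧(∀ Y:Fin N → ℝ → EuclideanSpace ℝ (Fin 3), (∀ j, ContDiff ℝ 2
      (Y j))→(∀ j τ, ⟪Y j τ, deriv (X p j) τ⟫_ℝ = 0) → ∑ j, ⟪Y j (c p j), cross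
      (EuclideanSpace.single 2 1) (X p j (c p j))⟫_ℝ = 0 → (∀ j τ, ‖Y j τ‖+‖deriv (Y j)
      τ‖+‖iteratedDeriv 2 (Y j) τ‖≤(1+|τ-c p j|)^b) → ∀ L:ℝ, (∀ j τ, ‖deriv (fun s:ℝ => T p (fun k σ
      => X p k σ+s • Y k σ) j τ) 0‖≤L*(1+|τ-c p j|)^a) → ∀ j τ, ‖Y j τ‖≤cnd*L*(1+|τ-c p j|)^b))) → ∃
      (C₀ M:ℝ) (U:(Fin N → ℝ) → EuclideanSpace ℝ (Fin 3) → EuclideanSpace ℝ (Fin 3)) (P:(Fin N → ℝ)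
      → EuclideanSpace ℝ (Fin 3) → ℝ) (B:(Fin N → ℝ) → Fin N → ℝ), (ContinuousOn B {p:Fin N → ℝ | ∀
      i, p i ∈ Icc 0 1} ∧ ∀ p:Fin N → ℝ, (∀ i, p i ∈ Icc 0 1) → U p ≠ 0 ∧ ContDiff ℝ (⊤:ℕ∞) (U p) ∧
      ContDiff ℝ (⊤:ℕ∞) (P p) ∧ VectorCalculus.IsDivFree (U p)∧(∀ y, α p • (cross
      (EuclideanSpace.single 2 1) (U p y)-fderiv ℝ (U p) y (cross (EuclideanSpace.single 2 1)
      y))+(1/2:ℝ) • U p y+(1/2:ℝ) • fderiv ℝ (U p) y y-(Laplacian.laplacian (U p)) y+fderiv ℝ (U p)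
      y (U p y)+gradient (P p) y = ∑ j, B p j • D p j y)∧(∀ y, ‖U p y‖≤C₀/(1+‖y‖))∧(∀ y, |P p
      y|≤M)∧(∀ y, ‖y‖≤Rw*√Γ → (∀ j τ, ρ*√Γ/4≤‖y-X p j τ‖) → ‖U p y-u p (X p) y‖≤η*√Γ))) := by
  rw [transverseReductionR_iff_nondegenerate]
  constructor
  · intro h N δ ρ K Λ a b cnd η Rw Rb cg θ₀ hN hδ hρ hη hRw hRb hcg hθ₀ h1 h2 hK h4 h5 h6
    exact h N δ ρ K Λ a b cnd η Rw Rb cg θ₀ hN hδ hρ hη hRw hRb hcg hθ₀ h1 h2 hK.le h4 h5 h6 fun _ => hK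
  · intro h N δ ρ K Λ a b cnd η Rw Rb cg θ₀ hN hδ hρ hη hRw hRb hcg hθ₀ h1 h2 _ h4 h5 h6 _
    by_cases hK : 0 < K
    · exact h N δ ρ K Λ a b cnd η Rw Rb cg θ₀ hN hδ hρ hη hRw hRb hcg hθ₀ h1 h2 hK h4 h5 h6
    · -- `K ≤ 0`: every filament is a straight line and the tangency clause fails for `Γ ≥ Γ₁`
      have hK' : K ≤ 0 := not_lt.1 hK
      obtain ⟨Γ₁, hΓ₁, hmain⟩ := straight_box_absurd hN hρ hRw hRb hθ₀
      refine ⟨Γ₁, fun Γ hΓ γ α X w c _ _ u v _ T _ hu hv _ _ _ hbox => ?_⟩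
      exfalso
      have hΓ0 : 0 < Γ := by linarith
      have hp₀ : ∀ i : Fin N, (fun _ => (0:ℝ)) i ∈ Icc (0:ℝ) 1 := fun _ => ⟨le_rfl, zero_le_one⟩
      obtain ⟨-, -, hreg, hsep, -, -, -, htan, hwaist, htilt, hbds, -, -, -⟩ :=
        hbox.2 (fun _ => (0:ℝ)) hp₀
      have hl := fun k => line_of_curv_nonpos hΓ0 hK' (hreg k).1 (hreg k).2.2.2.1 (c (fun _ => (0:ℝ)) k)
      exact hmain Γ hΓ (α fun _ => (0:ℝ)) (γ fun _ => (0:ℝ)) (X fun _ => (0:ℝ)) (w fun _ => (0:ℝ))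
        (c fun _ => (0:ℝ)) (u fun _ => (0:ℝ)) (v fun _ => (0:ℝ)) (hu fun _ => (0:ℝ))
        (hv fun _ => (0:ℝ)) (fun k τ => (hl k).1 τ) (fun k τ => (hl k).2 τ)
        (fun k => (hreg k).2.2.1 _) hsep htan hwaist htilt hbds.1 hbds.2.1 fun k => (hbds.2.2 k).2

end Summit.NavierStokesRegularity.NavierStokesRegularity.Theorems
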